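import Summits.BirchSwinnertonDyer.Rank1Residual.X11b.TorsionLevelCohomology
import Summits.BirchSwinnertonDyer.Rank1Residual.X11b.MaxUnramifiedRestriction
import Literature.NumberTheory.GaloisRepresentations.InertiaRootsOfUnity
import HarnessLib

/-!
# Unramified classes through an injective intertwining map `i : A ↪ B` with `B^{I_F}` killed by `n`:
# `H¹(i)⁻¹(H¹_ur(F, B)) = H¹_ur(F, A) ⊔ ker H¹(i)`
# (cell `b2b-bsdres`, team n1011, seat p06 GEN 5; OWNERS row T-E3g-DOOR, FILE B1 — generic part)

HONEST FRAMING (cell `b2b-bsdres`, run/shared/lean/b2b/bsd-rank1-residual/, verbatim in every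
file): the goal of the cell is to DELETE the COMBINATION-SHAPED residual classes of the
Birch–Swinnerton-Dyer formula for ALL analytic-rank `≤ 1` elliptic curves over `ℚ` — "full BSD
formula for every rank `≤ 1` curve in class `C`" assembled STRICTLY from published theorems — so
that the rank-`≤ 1` remainder becomes exactly the CONSTRUCTION-SHAPED classes, which are TYPED
(missing-input `Prop`s), NOT attempted. This is not "finishing BSD". Team n1011 (N10/N11: X4 ∧
`p = 3`): research routes on CONSTRUCTION-SHAPED classes; census output = EVIDENCE / conjecture
items, never a Literature fact; RESIDUAL-MAP marks UNCHANGED; nothing is booked by this file.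
THEOREMS ONLY: no definition, no named fact, nothing asserted; generic local Galois cohomology.

## What (row T-E3g-DOOR = r2 ROUTE-2 II.18.4 / ST-18.2 STEP 1; the generic half of FILE B)

`F` a non-archimedean local field, `i : A ↪ B` an injective intertwining map of discrete
`Γ_F`-modules with `A` killed by `n` and `range i ⊇ B[n]` (the Kummer-type sequence
`0 → A → B —n→ B`; for an elliptic curve: `E[p^k] ↪ E[p^∞]`), `I_F = absInertia F`:

* `mem_unramifiedSubgroup_sup_ker_map_of_principal_on_absInertia`: if `i ∘ φ` is principal on `I_F`
  (`i (φ τ) = τ b − b`, `τ ∈ I_F`) and every `I_F`-fixed point of `B` is killed by `n`, then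
  `[φ] ∈ H¹_ur(F, A) ⊔ ker H¹(i)` — the cocycle `σ ↦ i(φ σ) − (σ b − b)` vanishes on the NORMAL
  subgroup `I_F`, so its values are `I_F`-fixed, hence killed by `n`; therefore `n • b ∈ B^{Γ_F}`,
  the connecting class `δ(b)` (X11b `Levels.connectingClass`) is defined and dies under `H¹(i)`,
  and `φ − δ(b)` vanishes identically on `I_F`;
* `unramifiedSubgroup_sup_ker_le_comap_map_unramifiedSubgroup` (unconditional `⊇`) and
  `comap_map_unramifiedSubgroup_eq_sup_ker_of_inertia_torsion`:
  **`H¹(i)⁻¹(H¹_ur(F, B)) = H¹_ur(F, A) ⊔ ker H¹(i)`** under the inertia-torsion hypothesis.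

The companion of row T-E3g-ADD FILE A §1 (`unramifiedSubgroup_inf_ker_map_eq_bot_of_inertia_torsion`:
`H¹_ur(F, A) ⊓ ker H¹(i) = ⊥` under the same hypothesis): together, `H¹(i)⁻¹(H¹_ur(F, B))` is the
DIRECT sum `H¹_ur(F, A) ⊕ ker H¹(i)`.  Consumer: FILE B2 of this row (`Additive/UnramifiedKummerDoor.lean`,
the door converse for `E[p^k] ↪ E[p^∞]` at `v ∤ p`).

References: J. S. Milne, *ADT* (2006) I §2 (unramified cohomology `H¹(G/I, M^I)`), I Prop. 3.8
[MilneADT2006]; R. Greenberg, LNM 1716 (1999) §2 pp. 72–74 [GreenbergLNM1716]; J.-P. Serre,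
*Galois Cohomology* I §2, I §5.1 [SerreGaloisCohomology1997].
-/

set_option autoImplicit false

noncomputable section

open scoped Classical ContRepresentation

open CategoryTheory Field ValuativeRel Function
open Literature.NumberTheory.GaloisRepresentations
  Literature.NumberTheory.GaloisRepresentations.IsNonarchimedeanLocalField
open Summit.BirchSwinnertonDyer.Rank1Residual.X11b

namespace Summit.BirchSwinnertonDyer.Rank1Residual.Additive

universe u

/-! ### §1 Generic: principal on `I_F` after `i` ⟹ unramified + kernel class -/

section Generic

variable {F : Type u} [Field F] [ValuativeRel F] [TopologicalSpace F] [IsNonarchimedeanLocalField F]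
  {A B : Type u} [AddCommGroup A] [TopologicalSpace A] [DiscreteTopology A]
  [AddCommGroup B] [TopologicalSpace B] [DiscreteTopology B]
  {ρA : DiscreteGaloisModule F A} {ρB : DiscreteGaloisModule F B}

omit [ValuativeRel F] [TopologicalSpace F] [IsNonarchimedeanLocalField F] in
/-- Values of a difference of continuous crossed homomorphisms. [folklore] -/
theorem contOneCocycles_sub_apply (φ ψ : contOneCocycles ρA.toTopRep) (g : absoluteGaloisGroup F) :
    (φ - ψ).1 g = φ.1 g - ψ.1 g :=
  rfl

/-- **`[φ] ∈ H¹_ur(F, A) ⊔ ker H¹(i)` when `i ∘ φ` is principal on the inertia group and `B^{I_F}`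
is killed by `n`.** For an injective intertwining map `i : A ↪ B` of discrete `Γ_F`-modules over a
non-archimedean local field `F` with `A` killed by `n` and `range i ⊇ B[n]`, a continuous crossed
homomorphism `φ : Γ_F → A`, and `b ∈ B` with `i (φ τ) = τ b − b` for all `τ ∈ I_F`: if every
`I_F`-fixed point of `B` is killed by `n`, then `[φ]` is the sum of an unramified class and a class
dying under `H¹(i)` (namely the connecting class `δ(b)`).  (The cocycle
`ψ σ = i(φ σ) − (σ b − b)` vanishes on the normal subgroup `I_F`, so its values are `I_F`-fixed,
hence killed by `n`; thus `n • b ∈ B^{Γ_F}`, `δ(b)` is defined, and `φ − δ(b)` vanishes on `I_F`.)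
[cite: MilneADT2006, Ch. I §2 (unramified cohomology) and Prop. 3.8]
[cite: GreenbergLNM1716, §2, pp. 72–74] -/
theorem mem_unramifiedSubgroup_sup_ker_map_of_principal_on_absInertia
    {i : ρA.toContRepresentation →ⁱL ρB.toContRepresentation} {n : ℕ}
    (hrange : ∀ b : B, n • b = 0 → ∃ a : A, i a = b) (hinj : Function.Injective i)
    (hA : ∀ a : A, n • a = 0)
    (hI : ∀ b : B, (∀ τ ∈ absInertia F, ρB τ b = b) → n • b = 0)
    (φ : contOneCocycles ρA.toTopRep) {b : B}
    (hb : ∀ τ ∈ absInertia F, i (φ.1 τ) = ρB τ b - b) :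
    oneCocycleClass ρA.toTopRep φ ∈
      DiscreteGaloisModule.unramifiedSubgroup ρA 1 ⊔ (galoisCohomology.map i 1).ker := by
  have hmulB : ∀ (g h : absoluteGaloisGroup F) (x : B), ρB (g * h) x = ρB g (ρB h x) :=
    fun g h x ↦ by rw [map_mul, Module.End.mul_apply]
  -- `i ∘ φ` is a crossed homomorphism of `B`
  have hcoc : ∀ g h : absoluteGaloisGroup F, i (φ.1 (g * h)) = i (φ.1 g) + ρB g (i (φ.1 h)) := by
    intro g h
    rw [φ.2 g h, map_add]
    congr 1
    exact i.isIntertwining g (φ.1 h)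
  -- the defect `i (φ σ) - (σ b - b)` is fixed by the inertia group (`I_F` is normal)
  have hfix : ∀ (σ : absoluteGaloisGroup F), ∀ τ ∈ absInertia F,
      ρB τ (i (φ.1 σ) - (ρB σ b - b)) = i (φ.1 σ) - (ρB σ b - b) := by
    intro σ τ hτ
    have hτ' : σ⁻¹ * τ * σ ∈ absInertia F := by
      have h := (inferInstance : (absInertia F).Normal).conj_mem τ hτ σ⁻¹
      rwa [inv_inv] at h
    have e1 := hcoc τ σ
    have e2 := hcoc σ (σ⁻¹ * τ * σ)
    have hmul : σ * (σ⁻¹ * τ * σ) = τ * σ := by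
      simp only [← mul_assoc, mul_inv_cancel, one_mul]
    rw [hmul, hb _ hτ', map_sub, ← hmulB, hmul, hmulB] at e2
    rw [hb τ hτ] at e1
    have key : ρB τ (i (φ.1 σ)) = i (φ.1 σ) + (ρB τ (ρB σ b) - ρB σ b) - (ρB τ b - b) :=
      eq_sub_of_add_eq' (e1.symm.trans e2)
    rw [map_sub, map_sub, key]
    abel
  -- hence `n • b` is `Γ_F`-invariant
  have hbn : ∀ σ : absoluteGaloisGroup F, ρB σ (n • b) = n • b := by
    intro σ
    have h0 : n • (i (φ.1 σ) - (ρB σ b - b)) = 0 := hI _ (hfix σ)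
    have h1 : n • i (φ.1 σ) = 0 := by rw [← map_nsmul i, hA, map_zero]
    rw [smul_sub, h1, zero_sub, neg_eq_zero, smul_sub, sub_eq_zero, ← map_nsmul (ρB σ)] at h0
    exact h0
  -- `[φ] = [φ - lift(σ ↦ σ b - b)] + δ(b)` (names qualified: `liftCocycle` is ambiguous with
  -- `GaloisRepresentations.liftCocycle` under the opens of this file)
  refine AddSubgroup.mem_sup.mpr
    ⟨oneCocycleClass ρA.toTopRep
      (φ - Levels.liftCocycle i n hrange hinj (Levels.cobCocycle ρB b)
        (Levels.nsmul_cobCocycle_apply_eq_zero n hbn)),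
    ?_, Levels.connectingClass i n hrange hinj b hbn,
    (AddMonoidHom.mem_ker).mpr (Levels.map_connectingClass hinj b hbn), ?_⟩
  · -- `φ - lift(σ ↦ σ b - b)` vanishes identically on `I_F`
    refine (LocBridge.mem_unramifiedSubgroup_one_iff_exists ρA _).mpr ⟨0, fun τ hτ ↦ ?_⟩
    rw [map_zero, sub_zero, contOneCocycles_sub_apply]
    apply hinj
    rw [map_sub, Levels.apply_liftCocycle hinj (Levels.cobCocycle ρB b)
      (Levels.nsmul_cobCocycle_apply_eq_zero n hbn), Levels.cobCocycle_apply, hb τ hτ, sub_self,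
      map_zero]
  · rw [oneCocycleClass_sub, Levels.connectingClass, sub_add_cancel]

/-- **`H¹_ur(F, A) ⊔ ker H¹(i) ⊆ H¹(i)⁻¹(H¹_ur(F, B))`** for every intertwining map `i : A → B`
(unconditional): an unramified class maps to an unramified class (same witness, pushed by `i`),
and the kernel maps to `0`. [cite: MilneADT2006, Ch. I §2 (unramified cohomology)] -/
theorem unramifiedSubgroup_sup_ker_le_comap_map_unramifiedSubgroup
    (i : ρA.toContRepresentation →ⁱL ρB.toContRepresentation) :
    DiscreteGaloisModule.unramifiedSubgroup ρA 1 ⊔ (galoisCohomology.map i 1).ker ≤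
      (DiscreteGaloisModule.unramifiedSubgroup ρB 1).comap (galoisCohomology.map i 1) := by
  refine sup_le (fun c hc ↦ ?_) (fun c hc ↦ ?_)
  · obtain ⟨φ, rfl⟩ := oneCocycleClass_surjective _ c
    obtain ⟨w, hw⟩ := (LocBridge.mem_unramifiedSubgroup_one_iff_exists ρA φ).mp hc
    rw [AddSubgroup.mem_comap, galoisCohomology.map_one_oneCocycleClass]
    refine (LocBridge.mem_unramifiedSubgroup_one_iff_exists ρB _).mpr ⟨i w, fun τ hτ ↦ ?_⟩
    change i (φ.1 τ) = ρB τ (i w) - i w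
    rw [hw τ hτ, map_sub]
    congr 1
    exact i.isIntertwining τ w
  · rw [AddSubgroup.mem_comap, (AddMonoidHom.mem_ker).mp hc]
    exact zero_mem _

/-- **`H¹(i)⁻¹(H¹_ur(F, B)) = H¹_ur(F, A) ⊔ ker H¹(i)` when `B^{I_F}` is killed by `n`** (`i : A ↪ B`
injective intertwining, `A` killed by `n`, `range i ⊇ B[n]`): a class of `H¹(F, A)` becomes
unramified in `H¹(F, B)` iff it is unramified up to a class dying under `H¹(i)`.
[cite: MilneADT2006, Ch. I §2 (unramified cohomology) and Prop. 3.8]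
[cite: GreenbergLNM1716, §2, pp. 72–74] -/
theorem comap_map_unramifiedSubgroup_eq_sup_ker_of_inertia_torsion
    {i : ρA.toContRepresentation →ⁱL ρB.toContRepresentation} {n : ℕ}
    (hrange : ∀ b : B, n • b = 0 → ∃ a : A, i a = b) (hinj : Function.Injective i)
    (hA : ∀ a : A, n • a = 0)
    (hI : ∀ b : B, (∀ τ ∈ absInertia F, ρB τ b = b) → n • b = 0) :
    (DiscreteGaloisModule.unramifiedSubgroup ρB 1).comap (galoisCohomology.map i 1) =
      DiscreteGaloisModule.unramifiedSubgroup ρA 1 ⊔ (galoisCohomology.map i 1).ker := by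
  refine le_antisymm (fun c hc ↦ ?_) (unramifiedSubgroup_sup_ker_le_comap_map_unramifiedSubgroup i)
  obtain ⟨φ, rfl⟩ := oneCocycleClass_surjective _ c
  rw [AddSubgroup.mem_comap, galoisCohomology.map_one_oneCocycleClass] at hc
  obtain ⟨b, hb⟩ := (LocBridge.mem_unramifiedSubgroup_one_iff_exists ρB _).mp hc
  exact mem_unramifiedSubgroup_sup_ker_map_of_principal_on_absInertia hrange hinj hA hI φ hb

end Generic

end Summit.BirchSwinnertonDyer.Rank1Residual.Additive

end
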